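import Literature.NumberTheory.EllipticCurves.MillerStoll2013.IsogenyDescentShaTrivial
import Literature.NumberTheory.EllipticCurves.Rank1Residual.Typed.HigherDescentCertificate
import Literature.NumberTheory.EllipticCurves.Rank1Residual.Typed.X12
import Summits.BirchSwinnertonDyer.Rank1Residual.X12.ThreeIrrRecords
import HarnessLib

/-!
# X12 (CM, analytic rank one), the CM-RAMIFIED pairs of conductor `< 5000`: `BSD(E, ℓ)` per pair from
# Miller–Stoll 2013 Thm. 9.1 / Ex. 7.4 (`Ш(E/ℚ)[ℓ] = 0`, PRINTED) + GZK + the lane's `ord_ℓ #Ш_an = 0`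

HONEST FRAMING (cell `b2b-bsdres`, run/shared/lean/b2b/bsd-rank1-residual/, verbatim in every
file): the goal of the cell is to DELETE the COMBINATION-SHAPED residual classes of the
Birch–Swinnerton-Dyer formula for ALL analytic-rank `≤ 1` elliptic curves over `ℚ` — "full BSD
formula for every rank `≤ 1` curve in class `C`" assembled STRICTLY from published theorems — so
that the rank-`≤ 1` remainder becomes exactly the CONSTRUCTION-SHAPED classes, which are TYPED
(missing-input `Prop`s), NOT attempted. This is not "finishing BSD". Unit `b2b-bsdres-x1b`
(CLASS-OWNERS row "X12 inert-bad core", prover owner), generation 11; research route, no claim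
beyond the stated class; PER PAIR, not a class theorem; NOTHING booked (the lane books, under the
referee's conditions); X12 REMAINS CONSTRUCTION-SHAPED.

Theorems only (compositions of tree theorems BY NAME) + two curve records (`121b1`, `3025a1`) in the
fleet's `⟨((aᵢ : ℤ) : ℚ), …⟩` shape; no named fact here (the ONE published input is the named fact
`MillerStoll2013.sha_torsion_eq_zero_of_mem`, taken as the hypothesis `hMS`).

## What this file records

The 15 CM-RAMIFIED X12 pairs of the window `N < 2·10⁴` (`p ≥ 5`, `p ∣ d_K`, `E[p]` REDUCIBLE —
so neither Kolyvagin–Matar–Nekovář nor the class-level upper half of `X12/InertCoreUpperHalf.lean`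
applies, and Lawson–Wuthrich Thm. 14 is disputed in print) include EIGHT pairs of conductor
`< 5000`: `121b1 @ 11`, `361a1 @ 19`, `441d1 @ 7`, `784h1 @ 7`, `1849a1 @ 43`, `3025a1 @ 11`,
`3136r1 @ 7`, `4489a1 @ 67` (two of which, `1849a1 @ 43` and `4489a1 @ 67`, resisted the cell's two
`p`-isogeny-descent engines and were the subject of the owner's Eisenstein-descent memo). For exactly
these eight pairs Miller–Stoll, Math. Comp. 82 (2013), PROVE `Ш(ℚ, E)[ℓ] = Ш(ℚ, E′)[ℓ] = 0` by an
explicit `ℓ`-isogeny descent (Thm. 9.1, proof; Ex. 7.4) — a PRINTED per-curve statement, vendored as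
`MillerStoll2013.sha_torsion_eq_zero_of_mem`. This file composes it with the cell's typed shape:

* `natCard_torsionBy_one`, `bsdp_of_sha_torsion_eq_zero` — `Ш(E/ℚ)[p] = 0`, `ord_{s=1} L(E,s) ≤ 1`
  (so `Ш` finite and `rank = r_an` by GZK, `hGZK`) and `#Ш_an = q` with `ord_p q = 0` give Miller's
  `BSD(E, p)`: the `k = m = 0` instance of the cell's `Typed.bsdp_of_stable`
  (`Typed/HigherDescentCertificate.lean`: `Ш[p^(k+1)] = Ш[p^k]`, `#Ш[p^k] = p^m`, `ord_p #Ш_an = m`);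
* `bsdp_of_mem_shaTrivialCurves` — the same with `Ш[ℓ] = 0` supplied by the named fact at a listed
  pair, and `bsdp_of_classX12_of_mem_shaTrivialCurves` / `missingInputAt_of_classX12_of_mem_…` —
  at an X12 pair (`r_an = 1` by the class) the lane's exact `#Ш_an` closes `BSD(E, ℓ)` and the typed
  residue `X12.MissingInputAt`;
* the eight instances `bsdp_cremona121b1_11`, `…361a1_19`, `…441d1_7`, `…784h1_7`, `…1849a1_43`,
  `…3025a1_11`, `…3136r1_7`, `…4489a1_67` (membership in the printed list by `List.Mem.head/tail`,
  i.e. definitional unfolding of the fleet's curve records `X12.Records.cremona…` of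
  `ThreeIrrRecords.lean` / `GoodTwistRecordsD7D8.lean` and the two records below).

Inputs per instance: the PUBLISHED facts `hMS` (Miller–Stoll) and `hGZK` (Gross–Zagier–Kolyvagin,
bsd.S17) by name, `r_an ≤ 1` (`hr`, or the X12 class hypothesis) and the lane's exact `#Ш_an = q`,
`ord_ℓ q = 0` (`hq`, `hv`; `#Ш_an = 1` on all eight in the lane's tables). NOT covered here (outside
the printed list): `9025a1 @ 19` (`N = 9025 > 5000`) and the six window pairs of conductor `> 5000`
at `ℓ ∈ {7, 11}` (closed by the cell's descent lane) — for those the printed machine is Miller–Stoll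
Cor. 7.3 (1) with a class-number certificate (owner's memo `HOME/b2b-bsdres-x1b/X12-ROUTE.md` §14).
[cite: MillerStoll2013, Thm. 9.1 and Example 7.4] [cite: Miller2011LMS, §1 and Def. 1.1]
-/

noncomputable section

open scoped Classical

open WeierstrassCurve Literature.NumberTheory.EllipticCurves
  Literature.NumberTheory.EllipticCurves.Rank1Residual
  Literature.NumberTheory.EllipticCurves.Rank1Residual.Typed
  Literature.NumberTheory.EllipticCurves.MillerStoll2013
  Summit.BirchSwinnertonDyer.Rank1Residual.X11b
  Summit.BirchSwinnertonDyer.Rank1Residual.X12.Records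

namespace Summit.BirchSwinnertonDyer.Rank1Residual.X12

/-! ## §1 The `k = m = 0` case of the stabilisation certificate: `Ш[p] = 0` -/

/-- `A[1] = 0` has one element. [folklore] -/
theorem natCard_torsionBy_one (A : Type*) [AddCommGroup A] :
    Nat.card (AddSubgroup.torsionBy A ((1 : ℕ) : ℤ)) = 1 := by
  have h : AddSubgroup.torsionBy A ((1 : ℕ) : ℤ) = ⊥ := by
    ext x
    rw [AddSubgroup.torsionBy.nsmul_iff, one_smul, AddSubgroup.mem_bot]
  rw [h]
  exact AddSubgroup.card_bot

/-- **`Ш(E/ℚ)[p] = 0` + `ord_{s=1} L(E,s) ≤ 1` + `#Ш_an = q`, `ord_p q = 0` ⇒ `BSD(E, p)`.** The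
`k = m = 0` instance of `Typed.bsdp_of_stable`: `Ш[p] = Ш[1]` is the hypothesis `h0`, `#Ш[1] = 1 =
p^0` is `natCard_torsionBy_one`, `Ш` is finite and `rank = r_an` by GZK (`hGZK`). PER PAIR.
[cite: Miller2011LMS, §1 and Def. 1.1] -/
theorem bsdp_of_sha_torsion_eq_zero (hGZK : rank_eq_analyticRank_of_analyticRank_le_one)
    (W : WeierstrassCurve ℚ) [W.IsElliptic] (p : ℕ) [Fact p.Prime] (hr : W.analyticRank ≤ 1)
    (h0 : ∀ x : ↥W.sha, p • x = 0 → x = 0)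
    {q : ℚ} (hq : shaAn W = (q : ℂ)) (hv : padicValRat p q = 0) : BSDp W p := by
  refine bsdp_of_stable W p hGZK hr (k := 0) (m := 0) ?_ ?_ hq (by rw [Nat.cast_zero]; exact hv)
  · intro x hx
    rw [pow_zero, one_smul]
    exact h0 x (by rwa [zero_add, pow_one] at hx)
  · exact natCard_torsionBy_one _

/-! ## §2 At a pair of the printed list -/

/-- **Miller–Stoll 2013 Thm. 9.1 / Ex. 7.4 at a listed pair ⇒ `BSD(E, ℓ)`** given `r_an ≤ 1` and the
lane's `#Ш_an = q`, `ord_ℓ q = 0`. PER PAIR; nothing booked.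
[cite: MillerStoll2013, Thm. 9.1 and Example 7.4] [cite: Miller2011LMS, §1 and Def. 1.1] -/
theorem bsdp_of_mem_shaTrivialCurves (hMS : sha_torsion_eq_zero_of_mem)
    (hGZK : rank_eq_analyticRank_of_analyticRank_le_one)
    (W : WeierstrassCurve ℚ) [W.IsElliptic] (ℓ : ℕ) [Fact ℓ.Prime]
    (hmem : (W, ℓ) ∈ shaTrivialCurves) (hr : W.analyticRank ≤ 1)
    {q : ℚ} (hq : shaAn W = (q : ℂ)) (hv : padicValRat ℓ q = 0) : BSDp W ℓ :=
  bsdp_of_sha_torsion_eq_zero hGZK W ℓ hr (hMS W ℓ hmem) hq hv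

/-- **… at an X12 pair** (`r_an = 1` by the class). PER PAIR; nothing booked; X12 stays
CONSTRUCTION-SHAPED. [cite: MillerStoll2013, Thm. 9.1 and Example 7.4] -/
theorem bsdp_of_classX12_of_mem_shaTrivialCurves (hMS : sha_torsion_eq_zero_of_mem)
    (hGZK : rank_eq_analyticRank_of_analyticRank_le_one)
    (W : WeierstrassCurve ℚ) [W.IsElliptic] (ℓ : ℕ) [Fact ℓ.Prime] (hX : ClassX12 W ℓ)
    (hmem : (W, ℓ) ∈ shaTrivialCurves)
    {q : ℚ} (hq : shaAn W = (q : ℂ)) (hv : padicValRat ℓ q = 0) : BSDp W ℓ :=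
  bsdp_of_mem_shaTrivialCurves hMS hGZK W ℓ hmem (by rw [hX.2.1]) hq hv

/-- **… and the cell's typed residue `X12.MissingInputAt W ℓ` holds at such a pair.**
[cite: MillerStoll2013, Thm. 9.1 and Example 7.4] [cite: Miller2011LMS, §1 and Def. 1.1] -/
theorem missingInputAt_of_classX12_of_mem_shaTrivialCurves (hMS : sha_torsion_eq_zero_of_mem)
    (hGZK : rank_eq_analyticRank_of_analyticRank_le_one)
    (W : WeierstrassCurve ℚ) [W.IsElliptic] (ℓ : ℕ) [Fact ℓ.Prime] (hX : ClassX12 W ℓ)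
    (hmem : (W, ℓ) ∈ shaTrivialCurves)
    {q : ℚ} (hq : shaAn W = (q : ℂ)) (hv : padicValRat ℓ q = 0) : X12.MissingInputAt W ℓ :=
  fun _ ↦ by
    haveI : Finite W.sha := (hGZK W (by rw [hX.2.1])).2
    exact missingPPartAt_of_bsdp W ℓ
      (bsdp_of_classX12_of_mem_shaTrivialCurves hMS hGZK W ℓ hX hmem hq hv)

/-! ## §3 The eight CM-ramified X12 window pairs of conductor `< 5000` -/

namespace Records

/-- Cremona `121b1 = [0, −1, 1, −7, 10]` (`N = 11²`, `j = −32768`, CM by `ℤ[(1+√−11)/2]`; X12 pair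
at `ℓ = 11`, ramified). [cite: Cremona1997, Table 1 (curve 121b1)] -/
def cremona121b1 : WeierstrassCurve ℚ :=
  ⟨((0 : ℤ) : ℚ), ((-1 : ℤ) : ℚ), ((1 : ℤ) : ℚ), ((-7 : ℤ) : ℚ), ((10 : ℤ) : ℚ)⟩

/-- Cremona `3025a1 = [0, 1, 1, −183, 919]` (`N = 5²·11²`, `j = −32768`; the quadratic twist of
`121b1` by `5`; X12 pair at `ℓ = 11`, ramified). [cite: Cremona1997, Table 1 (curve 3025a1)] -/
def cremona3025a1 : WeierstrassCurve ℚ :=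
  ⟨((0 : ℤ) : ℚ), ((1 : ℤ) : ℚ), ((1 : ℤ) : ℚ), ((-183 : ℤ) : ℚ), ((919 : ℤ) : ℚ)⟩

/-- `121b1` is an elliptic curve (`Δ = −1331`). [cite: SilvermanAEC2009, III.1] -/
instance isElliptic_cremona121b1 : cremona121b1.IsElliptic :=
  isElliptic_of_discOf_ne_zero 0 (-1) 1 (-7) 10 (by decide)

/-- `3025a1` is an elliptic curve (`Δ = −20796875`). [cite: SilvermanAEC2009, III.1] -/
instance isElliptic_cremona3025a1 : cremona3025a1.IsElliptic :=
  isElliptic_of_discOf_ne_zero 0 1 1 (-183) 919 (by decide)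

end Records

/-- `(121b1, 11)` is the 3rd entry of Miller–Stoll's list. [cite: MillerStoll2013, Thm. 9.1] -/
theorem mem_shaTrivialCurves_cremona121b1 : (Records.cremona121b1, 11) ∈ shaTrivialCurves :=
  .tail _ <| .tail _ <| .head _

/-- `(361a1, 19)` is the 7th entry of Miller–Stoll's list. [cite: MillerStoll2013, Thm. 9.1] -/
theorem mem_shaTrivialCurves_cremona361a1 : (cremona361a1, 19) ∈ shaTrivialCurves :=
  .tail _ <| .tail _ <| .tail _ <| .tail _ <| .tail _ <| .tail _ <| .head _

/-- `(441d1, 7)` is the 9th entry of Miller–Stoll's list. [cite: MillerStoll2013, Thm. 9.1] -/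
theorem mem_shaTrivialCurves_cremona441d1 : (cremona441d1, 7) ∈ shaTrivialCurves :=
  .tail _ <| .tail _ <| .tail _ <| .tail _ <| .tail _ <| .tail _ <| .tail _ <| .tail _ <| .head _

/-- `(784h1, 7)` is the 11th entry of Miller–Stoll's list. [cite: MillerStoll2013, Thm. 9.1] -/
theorem mem_shaTrivialCurves_cremona784h1 : (cremona784h1, 7) ∈ shaTrivialCurves :=
  .tail _ <| .tail _ <| .tail _ <| .tail _ <| .tail _ <| .tail _ <| .tail _ <| .tail _ <|
    .tail _ <| .tail _ <| .head _

/-- `(1849a1, 43)` is the 13th entry of Miller–Stoll's list. [cite: MillerStoll2013, Thm. 9.1] -/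
theorem mem_shaTrivialCurves_cremona1849a1 : (cremona1849a1, 43) ∈ shaTrivialCurves :=
  .tail _ <| .tail _ <| .tail _ <| .tail _ <| .tail _ <| .tail _ <| .tail _ <| .tail _ <|
    .tail _ <| .tail _ <| .tail _ <| .tail _ <| .head _

/-- `(3025a1, 11)` is the 15th entry of Miller–Stoll's list. [cite: MillerStoll2013, Thm. 9.1] -/
theorem mem_shaTrivialCurves_cremona3025a1 : (Records.cremona3025a1, 11) ∈ shaTrivialCurves :=
  .tail _ <| .tail _ <| .tail _ <| .tail _ <| .tail _ <| .tail _ <| .tail _ <| .tail _ <|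
    .tail _ <| .tail _ <| .tail _ <| .tail _ <| .tail _ <| .tail _ <| .head _

/-- `(3136r1, 7)` is the 17th entry of Miller–Stoll's list. [cite: MillerStoll2013, Thm. 9.1] -/
theorem mem_shaTrivialCurves_cremona3136r1 : (cremona3136r1, 7) ∈ shaTrivialCurves :=
  .tail _ <| .tail _ <| .tail _ <| .tail _ <| .tail _ <| .tail _ <| .tail _ <| .tail _ <|
    .tail _ <| .tail _ <| .tail _ <| .tail _ <| .tail _ <| .tail _ <| .tail _ <| .tail _ <| .head _

/-- `(4489a1, 67)` is the 19th entry of Miller–Stoll's list. [cite: MillerStoll2013, Thm. 9.1] -/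
theorem mem_shaTrivialCurves_cremona4489a1 : (cremona4489a1, 67) ∈ shaTrivialCurves :=
  .tail _ <| .tail _ <| .tail _ <| .tail _ <| .tail _ <| .tail _ <| .tail _ <| .tail _ <|
    .tail _ <| .tail _ <| .tail _ <| .tail _ <| .tail _ <| .tail _ <| .tail _ <| .tail _ <|
    .tail _ <| .tail _ <| .head _

/-- `BSD(121b1, 11)` from Miller–Stoll Thm. 9.1 + GZK, given `r_an ≤ 1` and `ord₁₁ #Ш_an = 0`
(lane: `#Ш_an = 1`). PER PAIR; nothing booked. [cite: MillerStoll2013, Thm. 9.1 and Example 7.4] -/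
theorem bsdp_cremona121b1_11 (hMS : sha_torsion_eq_zero_of_mem)
    (hGZK : rank_eq_analyticRank_of_analyticRank_le_one)
    (hr : Records.cremona121b1.analyticRank ≤ 1) {q : ℚ}
    (hq : shaAn Records.cremona121b1 = (q : ℂ)) (hv : padicValRat 11 q = 0) :
    BSDp Records.cremona121b1 11 :=
  haveI : Fact (Nat.Prime 11) := ⟨by norm_num⟩
  bsdp_of_mem_shaTrivialCurves hMS hGZK _ 11 mem_shaTrivialCurves_cremona121b1 hr hq hv

/-- `BSD(361a1, 19)` likewise. [cite: MillerStoll2013, Thm. 9.1 and Example 7.4] -/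
theorem bsdp_cremona361a1_19 (hMS : sha_torsion_eq_zero_of_mem)
    (hGZK : rank_eq_analyticRank_of_analyticRank_le_one)
    (hr : cremona361a1.analyticRank ≤ 1) {q : ℚ}
    (hq : shaAn cremona361a1 = (q : ℂ)) (hv : padicValRat 19 q = 0) : BSDp cremona361a1 19 :=
  haveI : Fact (Nat.Prime 19) := ⟨by norm_num⟩
  bsdp_of_mem_shaTrivialCurves hMS hGZK _ 19 mem_shaTrivialCurves_cremona361a1 hr hq hv

/-- `BSD(441d1, 7)` likewise. [cite: MillerStoll2013, Thm. 9.1] -/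
theorem bsdp_cremona441d1_7 (hMS : sha_torsion_eq_zero_of_mem)
    (hGZK : rank_eq_analyticRank_of_analyticRank_le_one)
    (hr : cremona441d1.analyticRank ≤ 1) {q : ℚ}
    (hq : shaAn cremona441d1 = (q : ℂ)) (hv : padicValRat 7 q = 0) : BSDp cremona441d1 7 :=
  haveI : Fact (Nat.Prime 7) := ⟨by norm_num⟩
  bsdp_of_mem_shaTrivialCurves hMS hGZK _ 7 mem_shaTrivialCurves_cremona441d1 hr hq hv

/-- `BSD(784h1, 7)` likewise. [cite: MillerStoll2013, Thm. 9.1] -/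
theorem bsdp_cremona784h1_7 (hMS : sha_torsion_eq_zero_of_mem)
    (hGZK : rank_eq_analyticRank_of_analyticRank_le_one)
    (hr : cremona784h1.analyticRank ≤ 1) {q : ℚ}
    (hq : shaAn cremona784h1 = (q : ℂ)) (hv : padicValRat 7 q = 0) : BSDp cremona784h1 7 :=
  haveI : Fact (Nat.Prime 7) := ⟨by norm_num⟩
  bsdp_of_mem_shaTrivialCurves hMS hGZK _ 7 mem_shaTrivialCurves_cremona784h1 hr hq hv

/-- `BSD(1849a1, 43)` — Gross's `A(43)`, one of the cell's two formerly RESISTANT odd CM-ramified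
window pairs — from Miller–Stoll Thm. 9.1 / Ex. 7.4 + GZK, given `r_an ≤ 1` and `ord₄₃ #Ш_an = 0`.
PER PAIR; nothing booked. [cite: MillerStoll2013, Thm. 9.1 and Example 7.4] -/
theorem bsdp_cremona1849a1_43 (hMS : sha_torsion_eq_zero_of_mem)
    (hGZK : rank_eq_analyticRank_of_analyticRank_le_one)
    (hr : cremona1849a1.analyticRank ≤ 1) {q : ℚ}
    (hq : shaAn cremona1849a1 = (q : ℂ)) (hv : padicValRat 43 q = 0) : BSDp cremona1849a1 43 :=
  haveI : Fact (Nat.Prime 43) := ⟨by norm_num⟩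
  bsdp_of_mem_shaTrivialCurves hMS hGZK _ 43 mem_shaTrivialCurves_cremona1849a1 hr hq hv

/-- `BSD(3025a1, 11)` likewise. [cite: MillerStoll2013, Thm. 9.1] -/
theorem bsdp_cremona3025a1_11 (hMS : sha_torsion_eq_zero_of_mem)
    (hGZK : rank_eq_analyticRank_of_analyticRank_le_one)
    (hr : Records.cremona3025a1.analyticRank ≤ 1) {q : ℚ}
    (hq : shaAn Records.cremona3025a1 = (q : ℂ)) (hv : padicValRat 11 q = 0) :
    BSDp Records.cremona3025a1 11 :=
  haveI : Fact (Nat.Prime 11) := ⟨by norm_num⟩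
  bsdp_of_mem_shaTrivialCurves hMS hGZK _ 11 mem_shaTrivialCurves_cremona3025a1 hr hq hv

/-- `BSD(3136r1, 7)` likewise. [cite: MillerStoll2013, Thm. 9.1] -/
theorem bsdp_cremona3136r1_7 (hMS : sha_torsion_eq_zero_of_mem)
    (hGZK : rank_eq_analyticRank_of_analyticRank_le_one)
    (hr : cremona3136r1.analyticRank ≤ 1) {q : ℚ}
    (hq : shaAn cremona3136r1 = (q : ℂ)) (hv : padicValRat 7 q = 0) : BSDp cremona3136r1 7 :=
  haveI : Fact (Nat.Prime 7) := ⟨by norm_num⟩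
  bsdp_of_mem_shaTrivialCurves hMS hGZK _ 7 mem_shaTrivialCurves_cremona3136r1 hr hq hv

/-- `BSD(4489a1, 67)` — Gross's `A(67)`, the other formerly RESISTANT odd CM-ramified window pair —
from Miller–Stoll Thm. 9.1 / Ex. 7.4 + GZK, given `r_an ≤ 1` and `ord₆₇ #Ш_an = 0`. PER PAIR;
nothing booked. [cite: MillerStoll2013, Thm. 9.1 and Example 7.4] -/
theorem bsdp_cremona4489a1_67 (hMS : sha_torsion_eq_zero_of_mem)
    (hGZK : rank_eq_analyticRank_of_analyticRank_le_one)
    (hr : cremona4489a1.analyticRank ≤ 1) {q : ℚ}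
    (hq : shaAn cremona4489a1 = (q : ℂ)) (hv : padicValRat 67 q = 0) : BSDp cremona4489a1 67 :=
  haveI : Fact (Nat.Prime 67) := ⟨by norm_num⟩
  bsdp_of_mem_shaTrivialCurves hMS hGZK _ 67 mem_shaTrivialCurves_cremona4489a1 hr hq hv

end Summit.BirchSwinnertonDyer.Rank1Residual.X12

end
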